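import Summits.ValiantsHypothesis.ValiantsHypothesis.Theorems.SymPencilPerFourBasePointPackage
import Literature.Computability.AlgebraicComplexity.StandardFamilies
import Literature.Computability.AlgebraicComplexity.SymmDeterminantalComplexity
import Mathlib.FieldTheory.IsAlgClosed.Basic

/-!
# Route `SymPencil` — the base-point determinant is CONSTANT along the kernel space
# (over an algebraically closed field), and symmetric representations ascend along field maps
# (tool file for the size-`27` cells of `sdc(per_4)`, `--supports` stmt-ValiantsHypothesis-5674;
# rung currency only, nothing here bears on `VP ≠ VNP`)

Two bookkeeping facts used by the pencil-side attack on the size-`27` kernel-package table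
(`Cruxes/SdcPerBeyondN/NEXT-RUNG-H7.md`, `Cruxes/SdcSuperquadratic/TORIC-SIX.md` §X).

* `det_add_eq_det_of_isAlgClosed`: in the base-point package
  (`SymPencilPerFourBasePointPackage`) over an ALGEBRAICALLY CLOSED field, von zur Gathen
  regularity makes `D + CL v` invertible at every `v` of the kernel space, in particular along the
  whole line `t ↦ t v`; a univariate polynomial `t ↦ det (D + t CL v)` without roots is constant,
  so `det (D + CL v) = det D` (equivalently `det (1 + CL v D⁻¹) = 1`: `CL v D⁻¹` is nilpotent).
  This is the «nilpotency» that `NEXT-RUNG-H7.md` (H7.2) avoided for the one-row cells; the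
  cross-space endgame of the cell `(10,6,6)` uses it (`SymPencilPerFourCrossSix*`).
* `isSymm_map_and_isAffineDetRepr_map`: a symmetric affine determinantal representation of
  `per_n` over `K` pushes forward along any ring map `K →+* L` to one of `per_n` over `L`, of the
  same size (entrywise `MvPolynomial.map`; `map_perPoly`), so lower bounds proved over the algebraic
  closure descend to every field of characteristic `0` (`le_of_forall_isAlgClosed`-style use is
  left to the assembly files).

Elementary; no definitions, no named facts. [folklore]
-/

noncomputable section

-- single-conjunct layout: Sub = Summit, duplicated namespace component intended
set_option linter.dupNamespace false

namespace Summit.ValiantsHypothesis.ValiantsHypothesis.Theorems.SymPencilBasePointDetConst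

open Matrix MvPolynomial
open Literature.Computability.AlgebraicComplexity
open Summit.ValiantsHypothesis.ValiantsHypothesis.Theorems.SymPencilHomogeneousDropTools

universe u

section DetConst

variable {k : Type u} [Field k] {ι' : Type*} [Fintype ι'] [DecidableEq ι']

/-- **A univariate determinant pencil without roots over an algebraically closed field is
constant**: if `det (D + t N) ≠ 0` for every `t`, then `det (D + N) = det D`. [folklore] -/
theorem det_add_eq_det_of_forall_ne_zero [IsAlgClosed k] (D N : Matrix ι' ι' k)
    (h : ∀ t : k, (D + t • N).det ≠ 0) : (D + N).det = D.det := by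
  set δ : Polynomial k :=
    (D.map Polynomial.C + (Polynomial.X : Polynomial k) • N.map Polynomial.C).det with hδ
  have hdeg : δ.degree = 0 := by
    by_contra hne
    obtain ⟨t, ht⟩ := IsAlgClosed.exists_root δ hne
    rw [Polynomial.IsRoot.def, hδ, eval_detLine] at ht
    exact h t ht
  have hC : δ = Polynomial.C D.det := by
    rw [Polynomial.eq_C_of_degree_eq_zero hdeg, hδ, coeff_detLine_zero]
  have h1 := congr_arg (Polynomial.eval (1 : k)) hC
  rw [hδ, eval_detLine, one_smul, Polynomial.eval_C] at h1
  exact h1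

/-- **The base-point determinant is constant along the kernel space** (algebraically closed
field): if `D + CL v` is invertible for every `v` with `bL v = 0`, then `det (D + CL v) = det D`
for every such `v`. [folklore] -/
theorem det_add_eq_det_of_isAlgClosed [IsAlgClosed k] (D : Matrix ι' ι' k)
    (bL : (Fin 4 × Fin 4 → k) →ₗ[k] (ι' → k)) (CL : (Fin 4 × Fin 4 → k) →ₗ[k] Matrix ι' ι' k)
    (hN : ∀ v, bL v = 0 → IsUnit (D + CL v).det) (v : Fin 4 × Fin 4 → k) (hv : bL v = 0) :
    (D + CL v).det = D.det := by
  refine det_add_eq_det_of_forall_ne_zero D (CL v) fun t => ?_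
  have h := hN (t • v) (by rw [map_smul, hv, smul_zero])
  rw [map_smul] at h
  exact h.ne_zero

/-- The same along the scaled direction: `det (D + t CL v) = det D` for every `t`. [folklore] -/
theorem det_add_smul_eq_det_of_isAlgClosed [IsAlgClosed k] (D : Matrix ι' ι' k)
    (bL : (Fin 4 × Fin 4 → k) →ₗ[k] (ι' → k)) (CL : (Fin 4 × Fin 4 → k) →ₗ[k] Matrix ι' ι' k)
    (hN : ∀ v, bL v = 0 → IsUnit (D + CL v).det) (v : Fin 4 × Fin 4 → k) (hv : bL v = 0)
    (t : k) : (D + t • CL v).det = D.det := by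
  have h := det_add_eq_det_of_isAlgClosed D bL CL hN (t • v) (by rw [map_smul, hv, smul_zero])
  rwa [map_smul] at h

end DetConst

section BaseChange

variable {K L : Type*} [Field K] [Field L]

/-- **Symmetric affine determinantal representations ascend along ring maps**: the entrywise
image of a symmetric affine representation of `per_n` over `K` under `φ : K →+* L` is a symmetric
affine representation of `per_n` over `L`, of the same size. [folklore] -/
theorem isSymm_map_and_isAffineDetRepr_map (φ : K →+* L) {n m : ℕ}
    {A : Matrix (Fin m) (Fin m) (MvPolynomial (Fin n × Fin n) K)}
    (hS : A.IsSymm) (hA : IsAffineDetRepr (perPoly (Fin n) K) A) :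
    (A.map (MvPolynomial.map φ)).IsSymm ∧
      IsAffineDetRepr (perPoly (Fin n) L) (A.map (MvPolynomial.map φ)) := by
  obtain ⟨hdeg, hdet⟩ := hA
  refine ⟨?_, fun i j => ?_, ?_⟩
  · ext i j
    simp only [Matrix.transpose_apply, Matrix.map_apply, hS.apply i j]
  · rw [Matrix.map_apply]
    exact (Finset.sup_mono (MvPolynomial.support_map_subset φ (A i j))).trans (hdeg i j)
  · rw [← RingHom.mapMatrix_apply, ← RingHom.map_det, hdet, map_perPoly]

/-- Hence `HasSymmDetRepr (per_n) m` ascends along ring maps of fields. [folklore] -/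
theorem hasSymmDetRepr_perPoly_map (φ : K →+* L) {n m : ℕ}
    (h : HasSymmDetRepr (perPoly (Fin n) K) m) : HasSymmDetRepr (perPoly (Fin n) L) m := by
  obtain ⟨A, hS, hA⟩ := h
  exact ⟨_, isSymm_map_and_isAffineDetRepr_map φ hS hA⟩

/-- **Descent of size bounds**: if every symmetric affine representation of `per_n` over the
algebraic closure of `K` has size `≥ m₀`, then so does every symmetric affine representation over
`K`. [folklore] -/
theorem le_size_of_algebraicClosure {n m₀ : ℕ}
    (h : ∀ (m : ℕ) (A : Matrix (Fin m) (Fin m) (MvPolynomial (Fin n × Fin n) (AlgebraicClosure K))),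
      A.IsSymm → IsAffineDetRepr (perPoly (Fin n) (AlgebraicClosure K)) A → m₀ ≤ m)
    {m : ℕ} {A : Matrix (Fin m) (Fin m) (MvPolynomial (Fin n × Fin n) K)}
    (hS : A.IsSymm) (hA : IsAffineDetRepr (perPoly (Fin n) K) A) : m₀ ≤ m := by
  obtain ⟨hS', hA'⟩ :=
    isSymm_map_and_isAffineDetRepr_map (algebraMap K (AlgebraicClosure K)) hS hA
  exact h m _ hS' hA'

end BaseChange

end Summit.ValiantsHypothesis.ValiantsHypothesis.Theorems.SymPencilBasePointDetConst

end
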